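/-
Copyright (c) 2026 the pub-hodgecm-mathlib formalisation cell (harness21).  Prover seat hodgecm-mathlib-A-p19 (g24) — (U) road, U4-DISCHARGE (W2), explicit-constant chain link (d3a), 2026-09-01.
-/
import Literature.NumberTheory.Automorphic.ArchLocalWallAveraging                  -- ★ p840706 (d3a) + ★ p840556 (d2′): the ∃-packaged originals and every lemma their proofs use
import HarnessLib

/-!
# The (d3a) wall averaging with its constant EXPOSED: `c₀ = haarScalarFactor ρ ((μ₂ × μ₁).map e⁻¹) · μ₁(univ)` — and `c₀ = μ₁(univ)` for the product (top-form) centraliser measure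
# ((U) road, U4-DISCHARGE (W2) = CENSUS-Jval (b2), MEMO-U4-NC-v1 (n1)+(n4); Rogawski 1990 §8.2 p. 123)

Topic `NumberTheory/Automorphic`; namespace `Literature.NumberTheory.Automorphic.UnitaryGroup`.  THEOREMS ONLY (no `def`, no instance, no notation, no axiom, no named fact,
no `sorry`).  Cell `pub/hodgecm-mathlib`, crux H413 = `stmt-HodgeConjecture-24833` (supports only).  Count-neutral.  HONEST LABEL: HC_CM is proved only modulo the 2 remaining
named inputs (hLiu418, h413) until rung 0 closes; this file pays nothing by itself.

WHY.  The (J-nc) constant of the tree (★ closer p840819 ∕ `…Signed`) is `c = c₀ · C_R1G`, with `c₀` from ★ (d3a) `exists_integral_comp_conj_circleDiagonal_eq_mul_integral_averaged`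
(`∃ c₀ > 0`) and `C_R1G` from ★ (R1G).  U4's (nc) clause (★ p844462; owner junction ★ p844761) needs the VALUE of `c` for the top-form wall-block measure `θ^TF = ι_*(μ₂^TF ⊗ μ₁^TF)`,
so every `∃`-packaged constant on the road must be read explicitly (MEMO-U4-NC-v1 (n4)).  This file does it for (d2′)+(d3a), token for token over the ★ proofs:
* `fiberIntegral_comp_conj_wall_eq_haarScalarFactor_smul_integral_block` — ★ p840556's block unfolding with the witness `haarScalarFactor ρ ((μ₂.prod μ₁).map e.symm) · (μ₁ univ).toReal`;
* `integral_comp_conj_circleDiagonal_eq_haarScalarFactor_mul_integral_averaged` — ★ p840706's head with `c₀ := haarScalarFactor ρ ((μ₂.prod μ₁).map e.symm) · (μ₁ univ).toReal`;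
* `haarScalarFactor_mul_measure_univ_pos` — `0 < c₀` (★ `haarScalarFactor_map_symm_pos`, ★ `toReal_measure_univ_fin_one_unitary_pos`);
* `haarScalarFactor_map_symm_prod_self` — for the PRODUCT centraliser measure `ρ := (μ₂.prod μ₁).map e.symm` (the shape of U4's `θ^TF_w(β)`), the scalar is `1`, so `c₀ = μ₁(univ)` (n1).

## References
* [Rogawski1990] J. D. Rogawski, *Automorphic Representations of Unitary Groups in Three Variables*, Ann. of Math. Stud. 123 (1990), §8.2 p. 123; §4.8 Case (a) p. 53.
* [Folland1995] G. B. Folland, *A Course in Abstract Harmonic Analysis* (1995), §2.2 Thm. 2.20; §2.6 Thm. 2.49.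
-/

set_option autoImplicit false

noncomputable section

open MeasureTheory Measure NumberField NumberField.InfinitePlace Filter Topology
open Literature.MeasureTheory.Group Literature.NumberTheory.Rogawski1990
open scoped MatrixGroups Pointwise ComplexOrder NNReal ENNReal

namespace Literature.NumberTheory.Automorphic

namespace UnitaryGroup

section Wall

variable (L : Type) [Field L] (α : Fin 3 → L) (w : {w : InfinitePlace L // IsComplex w})
  [MeasurableSpace (archLocal L 3 (Matrix.diagonal α) w)] [BorelSpace (archLocal L 3 (Matrix.diagonal α) w)]
  [MeasurableSpace (unitaryGroupOfForm (starRingEnd ℂ) ((Matrix.diagonal ![α 0, α 2]).map w.1.embedding))]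
  [BorelSpace (unitaryGroupOfForm (starRingEnd ℂ) ((Matrix.diagonal ![α 0, α 2]).map w.1.embedding))]
  [MeasurableSpace (unitaryGroupOfForm (starRingEnd ℂ) ((Matrix.diagonal ![α 1]).map w.1.embedding))]
  [BorelSpace (unitaryGroupOfForm (starRingEnd ℂ) ((Matrix.diagonal ![α 1]).map w.1.embedding))]

/-! ## §1 (d2′) with the witness exposed -/

/-- **BLOCK UNFOLDING OF THE FIBRE INTEGRAL AT A WALL — EXPLICIT CONSTANT** (★ p840556 `exists_fiberIntegral_comp_conj_wall_eq_smul_integral_block` with its witness exposed):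
the constant is `haarScalarFactor ρ ((μ₂ × μ₁).map e⁻¹) · (μ₁ univ).toReal`; same proof, token for token. [cite: Rogawski1990, §8.2 p. 123; §4.8 Case (a) p. 53] [cite: Folland1995, §2.2 Thm. 2.20; §2.6] -/
theorem fiberIntegral_comp_conj_wall_eq_haarScalarFactor_smul_integral_block
    [SecondCountableTopology (archLocal L 3 (Matrix.diagonal α) w)] [LocallyCompactSpace (archLocal L 3 (Matrix.diagonal α) w)]
    [SecondCountableTopology (unitaryGroupOfForm (starRingEnd ℂ) ((Matrix.diagonal ![α 0, α 2]).map w.1.embedding))]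
    [LocallyCompactSpace (unitaryGroupOfForm (starRingEnd ℂ) ((Matrix.diagonal ![α 0, α 2]).map w.1.embedding))]
    [SecondCountableTopology (unitaryGroupOfForm (starRingEnd ℂ) ((Matrix.diagonal ![α 1]).map w.1.embedding))]
    [LocallyCompactSpace (unitaryGroupOfForm (starRingEnd ℂ) ((Matrix.diagonal ![α 1]).map w.1.embedding))]
    {z₀ : Fin 3 → Circle}
    (e : Subgroup.centralizer ({(⟨circleDiagonal 3 z₀, circleDiagonal_mem_archLocal_diagonal L 3 α w z₀⟩ : archLocal L 3 (Matrix.diagonal α) w)} :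
        Set (archLocal L 3 (Matrix.diagonal α) w)) ≃ₜ*
      (unitaryGroupOfForm (starRingEnd ℂ) ((Matrix.diagonal ![α 0, α 2]).map w.1.embedding) × unitaryGroupOfForm (starRingEnd ℂ) ((Matrix.diagonal ![α 1]).map w.1.embedding)))
    (he : ∀ p, ((e.symm p : Subgroup.centralizer ({(⟨circleDiagonal 3 z₀, circleDiagonal_mem_archLocal_diagonal L 3 α w z₀⟩ : archLocal L 3 (Matrix.diagonal α) w)} :
        Set (archLocal L 3 (Matrix.diagonal α) w))) : archLocal L 3 (Matrix.diagonal α) w) =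
      (endoEmb (starRingEnd ℂ) ((Matrix.diagonal ![α 0, α 2]).map w.1.embedding) ((Matrix.diagonal ![α 1]).map w.1.embedding)
        ((Matrix.diagonal α).map w.1.embedding) (endoForm_archLocal_diagonal L α w)) p)
    (ρ : Measure (Subgroup.centralizer ({(⟨circleDiagonal 3 z₀, circleDiagonal_mem_archLocal_diagonal L 3 α w z₀⟩ : archLocal L 3 (Matrix.diagonal α) w)} :
        Set (archLocal L 3 (Matrix.diagonal α) w)))) [ρ.IsHaarMeasure]
    (μ₂ : Measure (unitaryGroupOfForm (starRingEnd ℂ) ((Matrix.diagonal ![α 0, α 2]).map w.1.embedding))) [μ₂.IsHaarMeasure]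
    (μ₁ : Measure (unitaryGroupOfForm (starRingEnd ℂ) ((Matrix.diagonal ![α 1]).map w.1.embedding))) [μ₁.IsHaarMeasure] :
    haveI : ((μ₂.prod μ₁).map e.symm).IsHaarMeasure := ContinuousMulEquiv.isHaarMeasure_map (μ₂.prod μ₁) e.symm
    ∀ (g : archLocal L 3 (Matrix.diagonal α) w) (z : Fin 3 → Circle) {E : Type} [NormedAddCommGroup E] [NormedSpace ℝ E]
      (Θ : Matrix (Fin 3) (Fin 3) ℂ → E), Continuous Θ →
      ∫ h : Subgroup.centralizer ({(⟨circleDiagonal 3 z₀, circleDiagonal_mem_archLocal_diagonal L 3 α w z₀⟩ : archLocal L 3 (Matrix.diagonal α) w)} :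
            Set (archLocal L 3 (Matrix.diagonal α) w)),
          Θ ((((g * ((h : archLocal L 3 (Matrix.diagonal α) w) * ⟨circleDiagonal 3 z, circleDiagonal_mem_archLocal_diagonal L 3 α w z⟩ *
            (h : archLocal L 3 (Matrix.diagonal α) w)⁻¹) * g⁻¹ : archLocal L 3 (Matrix.diagonal α) w) : GL (Fin 3) ℂ) : Matrix (Fin 3) (Fin 3) ℂ)) ∂ρ =
        ((haarScalarFactor ρ ((μ₂.prod μ₁).map e.symm) : ℝ) * (μ₁ Set.univ).toReal) •
          ∫ h₂ : unitaryGroupOfForm (starRingEnd ℂ) ((Matrix.diagonal ![α 0, α 2]).map w.1.embedding),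
            Θ (((g : GL (Fin 3) ℂ) : Matrix (Fin 3) (Fin 3) ℂ) *
              endoForm ((((h₂ * ⟨circleDiagonal 2 ![z 0, z 2], (circleDiagonal_blocks_mem L α w z).1⟩ * h₂⁻¹ :
                  unitaryGroupOfForm (starRingEnd ℂ) ((Matrix.diagonal ![α 0, α 2]).map w.1.embedding)) : GL (Fin 2) ℂ) : Matrix (Fin 2) (Fin 2) ℂ))
                ((((⟨circleDiagonal 1 ![z 1], (circleDiagonal_blocks_mem L α w z).2⟩ :
                  unitaryGroupOfForm (starRingEnd ℂ) ((Matrix.diagonal ![α 1]).map w.1.embedding)) : GL (Fin 1) ℂ) : Matrix (Fin 1) (Fin 1) ℂ)) *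
              ((((g : GL (Fin 3) ℂ))⁻¹ : GL (Fin 3) ℂ) : Matrix (Fin 3) (Fin 3) ℂ)) ∂μ₂ := by
  haveI : ((μ₂.prod μ₁).map e.symm).IsHaarMeasure := ContinuousMulEquiv.isHaarMeasure_map (μ₂.prod μ₁) e.symm
  intro g z E _ _ Θ hΘ
  -- names for the two integrands
  obtain ⟨φ, hφ⟩ : ∃ φ : Subgroup.centralizer ({(⟨circleDiagonal 3 z₀, circleDiagonal_mem_archLocal_diagonal L 3 α w z₀⟩ : archLocal L 3 (Matrix.diagonal α) w)} :
      Set (archLocal L 3 (Matrix.diagonal α) w)) → E, φ = fun h : Subgroup.centralizer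
        ({(⟨circleDiagonal 3 z₀, circleDiagonal_mem_archLocal_diagonal L 3 α w z₀⟩ : archLocal L 3 (Matrix.diagonal α) w)} : Set (archLocal L 3 (Matrix.diagonal α) w)) =>
        Θ ((((g * ((h : archLocal L 3 (Matrix.diagonal α) w) * ⟨circleDiagonal 3 z, circleDiagonal_mem_archLocal_diagonal L 3 α w z⟩ *
          (h : archLocal L 3 (Matrix.diagonal α) w)⁻¹) * g⁻¹ : archLocal L 3 (Matrix.diagonal α) w) : GL (Fin 3) ℂ) : Matrix (Fin 3) (Fin 3) ℂ)) := ⟨_, rfl⟩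
  obtain ⟨F₂, hF₂⟩ : ∃ F₂ : unitaryGroupOfForm (starRingEnd ℂ) ((Matrix.diagonal ![α 0, α 2]).map w.1.embedding) → E, F₂ =
      fun h₂ : unitaryGroupOfForm (starRingEnd ℂ) ((Matrix.diagonal ![α 0, α 2]).map w.1.embedding) =>
      Θ (((g : GL (Fin 3) ℂ) : Matrix (Fin 3) (Fin 3) ℂ) *
        endoForm ((((h₂ * ⟨circleDiagonal 2 ![z 0, z 2], (circleDiagonal_blocks_mem L α w z).1⟩ * h₂⁻¹ :
            unitaryGroupOfForm (starRingEnd ℂ) ((Matrix.diagonal ![α 0, α 2]).map w.1.embedding)) : GL (Fin 2) ℂ) : Matrix (Fin 2) (Fin 2) ℂ))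
          ((((⟨circleDiagonal 1 ![z 1], (circleDiagonal_blocks_mem L α w z).2⟩ :
            unitaryGroupOfForm (starRingEnd ℂ) ((Matrix.diagonal ![α 1]).map w.1.embedding)) : GL (Fin 1) ℂ) : Matrix (Fin 1) (Fin 1) ℂ)) *
        ((((g : GL (Fin 3) ℂ))⁻¹ : GL (Fin 3) ℂ) : Matrix (Fin 3) (Fin 3) ℂ)) := ⟨_, rfl⟩
  -- (2) the `Z`-integrand at `e⁻¹ p = ι p` depends on `p.1` only and is `F₂ p.1`
  have hint : ∀ p, φ (e.symm p) = F₂ p.1 := fun p => by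
    rw [hφ, hF₂]
    dsimp only
    rw [he p]
    -- `archLocal` is a `def` over `unitaryGroupOfForm`: the block identity is used up to that unfolding
    erw [endoEmb_mul_circleDiagonal_mul_inv L α w p z]
    rw [Subgroup.coe_mul, Subgroup.coe_mul, Subgroup.coe_inv, Units.val_mul, Units.val_mul, coe_coe_endoEmb_eq_endoForm]
  -- (3) `F₂` is continuous
  have hblock : Continuous fun X : Matrix (Fin 2) (Fin 2) ℂ => endoForm X
      ((((⟨circleDiagonal 1 ![z 1], (circleDiagonal_blocks_mem L α w z).2⟩ :
        unitaryGroupOfForm (starRingEnd ℂ) ((Matrix.diagonal ![α 1]).map w.1.embedding)) : GL (Fin 1) ℂ) : Matrix (Fin 1) (Fin 1) ℂ)) := by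
    unfold endoForm
    simp only [Matrix.reindex_apply]
    exact (continuous_id.matrix_fromBlocks continuous_const continuous_const continuous_const).matrix_submatrix _ _
  have hd : Continuous fun h₂ : unitaryGroupOfForm (starRingEnd ℂ) ((Matrix.diagonal ![α 0, α 2]).map w.1.embedding) =>
      ((((h₂ * ⟨circleDiagonal 2 ![z 0, z 2], (circleDiagonal_blocks_mem L α w z).1⟩ * h₂⁻¹ :
        unitaryGroupOfForm (starRingEnd ℂ) ((Matrix.diagonal ![α 0, α 2]).map w.1.embedding)) : GL (Fin 2) ℂ) : Matrix (Fin 2) (Fin 2) ℂ)) :=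
    (Units.continuous_val.comp continuous_subtype_val).comp ((continuous_id.mul continuous_const).mul continuous_id.inv)
  have hF₂c : Continuous F₂ := by
    rw [hF₂]
    exact hΘ.comp ((continuous_const.matrix_mul (hblock.comp hd)).matrix_mul continuous_const)
  -- (1)+(2)+(3): Haar transport along `e`, then integrate out the `G₁` factor
  have key : ∫ h, φ h ∂ρ = ((haarScalarFactor ρ ((μ₂.prod μ₁).map e.symm) : ℝ) * (μ₁ Set.univ).toReal) • ∫ x, F₂ x ∂μ₂ := by
    rw [integral_eq_haarScalarFactor_smul_integral_comp_symm _ (isClosed_coe_centralizer_singleton _) e ρ (μ₂.prod μ₁) φ, mul_smul]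
    congr 1
    simp_rw [hint]
    exact integral_prod_comp_fst μ₂ μ₁ F₂ hF₂c.aestronglyMeasurable
  rw [hφ, hF₂] at key
  exact key

/-! ## §2 (d3a) with the witness exposed -/

/-- **THE TORUS ORBITAL FUNCTION NEAR A WALL AS THE `G₂`-TORUS ORBITAL INTEGRAL OF ONE AVERAGED TEST FUNCTION — EXPLICIT CONSTANT** (★ p840706
`exists_integral_comp_conj_circleDiagonal_eq_mul_integral_averaged` with its witness exposed): `c₀ = haarScalarFactor ρ ((μ₂ × μ₁).map e⁻¹) · (μ₁ univ).toReal`; same proof, token for token,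
over the explicit fibre lemma above.  This is the (d3a) link of the explicit-constant chain for the (J-nc) constant ((U) road, U4-DISCHARGE (W2), MEMO-U4-NC-v1 (n4)).
[cite: Rogawski1990, §8.2 p. 123; §4.8 Case (a) p. 53] [cite: Folland1995, §2.6 Thm. 2.49] -/
theorem integral_comp_conj_circleDiagonal_eq_haarScalarFactor_mul_integral_averaged (hα : ∀ i, α i ≠ 0) (hreal : ∀ i, (w.1.embedding (α i)).im = 0)
    [SecondCountableTopology (archLocal L 3 (Matrix.diagonal α) w)] [LocallyCompactSpace (archLocal L 3 (Matrix.diagonal α) w)]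
    [SecondCountableTopology (unitaryGroupOfForm (starRingEnd ℂ) ((Matrix.diagonal ![α 0, α 2]).map w.1.embedding))]
    [LocallyCompactSpace (unitaryGroupOfForm (starRingEnd ℂ) ((Matrix.diagonal ![α 0, α 2]).map w.1.embedding))]
    [SecondCountableTopology (unitaryGroupOfForm (starRingEnd ℂ) ((Matrix.diagonal ![α 1]).map w.1.embedding))]
    [LocallyCompactSpace (unitaryGroupOfForm (starRingEnd ℂ) ((Matrix.diagonal ![α 1]).map w.1.embedding))]
    {z₁ : Fin 3 → Circle}
    (e : Subgroup.centralizer ({(⟨circleDiagonal 3 z₁, circleDiagonal_mem_archLocal_diagonal L 3 α w z₁⟩ : archLocal L 3 (Matrix.diagonal α) w)} : Set (archLocal L 3 (Matrix.diagonal α) w)) ≃ₜ*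
      (unitaryGroupOfForm (starRingEnd ℂ) ((Matrix.diagonal ![α 0, α 2]).map w.1.embedding) × unitaryGroupOfForm (starRingEnd ℂ) ((Matrix.diagonal ![α 1]).map w.1.embedding)))
    (he : ∀ p, ((e.symm p : Subgroup.centralizer ({(⟨circleDiagonal 3 z₁, circleDiagonal_mem_archLocal_diagonal L 3 α w z₁⟩ : archLocal L 3 (Matrix.diagonal α) w)} : Set (archLocal L 3 (Matrix.diagonal α) w))) : archLocal L 3 (Matrix.diagonal α) w) =
      (endoEmb (starRingEnd ℂ) ((Matrix.diagonal ![α 0, α 2]).map w.1.embedding) ((Matrix.diagonal ![α 1]).map w.1.embedding)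
        ((Matrix.diagonal α).map w.1.embedding) (endoForm_archLocal_diagonal L α w)) p)
    (ρ : Measure (Subgroup.centralizer ({(⟨circleDiagonal 3 z₁, circleDiagonal_mem_archLocal_diagonal L 3 α w z₁⟩ : archLocal L 3 (Matrix.diagonal α) w)} : Set (archLocal L 3 (Matrix.diagonal α) w)))) [ρ.IsHaarMeasure] [ρ.IsInvInvariant]
    (μ₂ : Measure (unitaryGroupOfForm (starRingEnd ℂ) ((Matrix.diagonal ![α 0, α 2]).map w.1.embedding))) [μ₂.IsHaarMeasure]
    (μ₁ : Measure (unitaryGroupOfForm (starRingEnd ℂ) ((Matrix.diagonal ![α 1]).map w.1.embedding))) [μ₁.IsHaarMeasure]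
    (ν : Measure (archLocal L 3 (Matrix.diagonal α) w)) [ν.IsHaarMeasure] [ν.IsMulRightInvariant] :
    haveI : ((μ₂.prod μ₁).map e.symm).IsHaarMeasure := ContinuousMulEquiv.isHaarMeasure_map (μ₂.prod μ₁) e.symm
    ∀ (β : archLocal L 3 (Matrix.diagonal α) w → ℝ), Continuous β → HasCompactSupport β →
      ∀ (z : Fin 3 → Circle), (∀ i j, i ≠ j → z i ≠ z j) →
      ∀ (Θ : Matrix (Fin 3) (Fin 3) ℂ → ℂ), Continuous Θ → HasCompactSupport (fun k : archLocal L 3 (Matrix.diagonal α) w => Θ ((k : GL (Fin 3) ℂ) : Matrix (Fin 3) (Fin 3) ℂ)) →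
      (∀ g : archLocal L 3 (Matrix.diagonal α) w, Θ (((g * (⟨circleDiagonal 3 z, circleDiagonal_mem_archLocal_diagonal L 3 α w z⟩ : archLocal L 3 (Matrix.diagonal α) w) * g⁻¹ : archLocal L 3 (Matrix.diagonal α) w) : GL (Fin 3) ℂ) : Matrix (Fin 3) (Fin 3) ℂ) ≠ 0 →
          ∫ h : Subgroup.centralizer ({(⟨circleDiagonal 3 z₁, circleDiagonal_mem_archLocal_diagonal L 3 α w z₁⟩ : archLocal L 3 (Matrix.diagonal α) w)} : Set (archLocal L 3 (Matrix.diagonal α) w)), β (g * h) ∂ρ = 1) →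
      ∫ g, Θ (((g * (⟨circleDiagonal 3 z, circleDiagonal_mem_archLocal_diagonal L 3 α w z⟩ : archLocal L 3 (Matrix.diagonal α) w) * g⁻¹ : archLocal L 3 (Matrix.diagonal α) w) : GL (Fin 3) ℂ) : Matrix (Fin 3) (Fin 3) ℂ) ∂ν =
        (((haarScalarFactor ρ ((μ₂.prod μ₁).map e.symm) : ℝ) * (μ₁ Set.univ).toReal : ℝ) : ℂ) * ∫ h₂ : unitaryGroupOfForm (starRingEnd ℂ) ((Matrix.diagonal ![α 0, α 2]).map w.1.embedding), ∫ g, (β g : ℂ) *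
          Θ (((g : GL (Fin 3) ℂ) : Matrix (Fin 3) (Fin 3) ℂ) * endoForm (((h₂ * ⟨circleDiagonal 2 ![z 0, z 2], (circleDiagonal_blocks_mem L α w z).1⟩ * h₂⁻¹ : unitaryGroupOfForm (starRingEnd ℂ) ((Matrix.diagonal ![α 0, α 2]).map w.1.embedding)) : GL (Fin 2) ℂ) : Matrix (Fin 2) (Fin 2) ℂ) ((circleDiagonal 1 ![z 1] : GL (Fin 1) ℂ) : Matrix (Fin 1) (Fin 1) ℂ) * (((g : GL (Fin 3) ℂ)⁻¹ : GL (Fin 3) ℂ) : Matrix (Fin 3) (Fin 3) ℂ)) ∂ν ∂μ₂ := by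
  have hZ : IsClosed ((Subgroup.centralizer ({(⟨circleDiagonal 3 z₁, circleDiagonal_mem_archLocal_diagonal L 3 α w z₁⟩ : archLocal L 3 (Matrix.diagonal α) w)} : Set (archLocal L 3 (Matrix.diagonal α) w))) : Set (archLocal L 3 (Matrix.diagonal α) w)) :=
    isClosed_coe_centralizer_singleton _
  haveI : ((μ₂.prod μ₁).map e.symm).IsHaarMeasure := ContinuousMulEquiv.isHaarMeasure_map (μ₂.prod μ₁) e.symm
  have hd := fiberIntegral_comp_conj_wall_eq_haarScalarFactor_smul_integral_block L α w e he ρ μ₂ μ₁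
  set c : ℝ := (haarScalarFactor ρ ((μ₂.prod μ₁).map e.symm) : ℝ) with hc_def
  intro β hβ hβs z hz Θ hΘ hΘs h1
  have hcoe : Continuous fun k : archLocal L 3 (Matrix.diagonal α) w => ((k : GL (Fin 3) ℂ) : Matrix (Fin 3) (Fin 3) ℂ) := Units.continuous_val.comp continuous_subtype_val
  have hΘk : Continuous fun k : archLocal L 3 (Matrix.diagonal α) w => Θ ((k : GL (Fin 3) ℂ) : Matrix (Fin 3) (Fin 3) ℂ) := hΘ.comp hcoe
  have hus : HasCompactSupport fun x : archLocal L 3 (Matrix.diagonal α) w => Θ (((x * (⟨circleDiagonal 3 z, circleDiagonal_mem_archLocal_diagonal L 3 α w z⟩ : archLocal L 3 (Matrix.diagonal α) w) * x⁻¹ : archLocal L 3 (Matrix.diagonal α) w) : GL (Fin 3) ℂ) : Matrix (Fin 3) (Fin 3) ℂ) :=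
    hasCompactSupport_comp_conj_circleDiagonal_of_blocks L 3 α w hα hreal id (fun i j hij h => absurd h hij) (fun i j hij => hz i j hij)
      (fun k : archLocal L 3 (Matrix.diagonal α) w => Θ ((k : GL (Fin 3) ℂ) : Matrix (Fin 3) (Fin 3) ℂ)) hΘs
  -- STEP 1 (§1): trade the fibre cut-off for the `H_w`-orbital average
  rw [integral_conj_eq_integral_mul_orbitalFiber_of_fiber_eq_one _ hZ ρ ν β hβ hβs _ (fun k : archLocal L 3 (Matrix.diagonal α) w => Θ ((k : GL (Fin 3) ℂ) : Matrix (Fin 3) (Fin 3) ℂ)) hΘk hus h1]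
  -- STEP 2 (★ (d2′)): the `H_w`-orbital average is `(c·m₁) •` the `G₂`-torus orbital function of `X ↦ Θ(↑↑g · endoForm X (diag z(1)) · (↑↑g)⁻¹)`
  have hstep2 : ∀ g : archLocal L 3 (Matrix.diagonal α) w,
      ∫ h : Subgroup.centralizer ({(⟨circleDiagonal 3 z₁, circleDiagonal_mem_archLocal_diagonal L 3 α w z₁⟩ : archLocal L 3 (Matrix.diagonal α) w)} : Set (archLocal L 3 (Matrix.diagonal α) w)),
        Θ (((g * ((h : archLocal L 3 (Matrix.diagonal α) w) * (⟨circleDiagonal 3 z, circleDiagonal_mem_archLocal_diagonal L 3 α w z⟩ : archLocal L 3 (Matrix.diagonal α) w) * (h : archLocal L 3 (Matrix.diagonal α) w)⁻¹) * g⁻¹ : archLocal L 3 (Matrix.diagonal α) w) : GL (Fin 3) ℂ) : Matrix (Fin 3) (Fin 3) ℂ) ∂ρ =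
      (((c * (μ₁ Set.univ).toReal : ℝ)) : ℂ) * ∫ h₂ : unitaryGroupOfForm (starRingEnd ℂ) ((Matrix.diagonal ![α 0, α 2]).map w.1.embedding),
          Θ (((g : GL (Fin 3) ℂ) : Matrix (Fin 3) (Fin 3) ℂ) * endoForm (((h₂ * ⟨circleDiagonal 2 ![z 0, z 2], (circleDiagonal_blocks_mem L α w z).1⟩ * h₂⁻¹ : unitaryGroupOfForm (starRingEnd ℂ) ((Matrix.diagonal ![α 0, α 2]).map w.1.embedding)) : GL (Fin 2) ℂ) : Matrix (Fin 2) (Fin 2) ℂ) ((circleDiagonal 1 ![z 1] : GL (Fin 1) ℂ) : Matrix (Fin 1) (Fin 1) ℂ) * (((g : GL (Fin 3) ℂ)⁻¹ : GL (Fin 3) ℂ) : Matrix (Fin 3) (Fin 3) ℂ)) ∂μ₂ := fun g => by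
    rw [← Complex.real_smul]
    exact hd g z Θ hΘ
  simp_rw [hstep2]
  -- STEP 3: Fubini on `G_w × G₂` (the integrand is `C_c`)
  have hblock : Continuous fun X : Matrix (Fin 2) (Fin 2) ℂ => endoForm X ((circleDiagonal 1 ![z 1] : GL (Fin 1) ℂ) : Matrix (Fin 1) (Fin 1) ℂ) := by
    unfold endoForm
    simp only [Matrix.reindex_apply]
    exact (continuous_id.matrix_fromBlocks continuous_const continuous_const continuous_const).matrix_submatrix _ _
  have hd₂ : Continuous fun h₂ : unitaryGroupOfForm (starRingEnd ℂ) ((Matrix.diagonal ![α 0, α 2]).map w.1.embedding) =>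
      (((h₂ * ⟨circleDiagonal 2 ![z 0, z 2], (circleDiagonal_blocks_mem L α w z).1⟩ * h₂⁻¹ : unitaryGroupOfForm (starRingEnd ℂ) ((Matrix.diagonal ![α 0, α 2]).map w.1.embedding)) : GL (Fin 2) ℂ) : Matrix (Fin 2) (Fin 2) ℂ) :=
    (Units.continuous_val.comp continuous_subtype_val).comp ((continuous_id.mul continuous_const).mul continuous_id.inv)
  have hF₃i : Integrable (Function.uncurry fun (g : archLocal L 3 (Matrix.diagonal α) w) (h₂ : unitaryGroupOfForm (starRingEnd ℂ) ((Matrix.diagonal ![α 0, α 2]).map w.1.embedding)) => (β g : ℂ) *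
      Θ (((g : GL (Fin 3) ℂ) : Matrix (Fin 3) (Fin 3) ℂ) * endoForm (((h₂ * ⟨circleDiagonal 2 ![z 0, z 2], (circleDiagonal_blocks_mem L α w z).1⟩ * h₂⁻¹ : unitaryGroupOfForm (starRingEnd ℂ) ((Matrix.diagonal ![α 0, α 2]).map w.1.embedding)) : GL (Fin 2) ℂ) : Matrix (Fin 2) (Fin 2) ℂ) ((circleDiagonal 1 ![z 1] : GL (Fin 1) ℂ) : Matrix (Fin 1) (Fin 1) ℂ) * (((g : GL (Fin 3) ℂ)⁻¹ : GL (Fin 3) ℂ) : Matrix (Fin 3) (Fin 3) ℂ))) (ν.prod μ₂) := by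
    refine Continuous.integrable_of_hasCompactSupport ?_ ?_
    · exact (Complex.continuous_ofReal.comp (hβ.comp continuous_fst)).mul
        (hΘ.comp ((((hcoe.comp continuous_fst).matrix_mul ((hblock.comp hd₂).comp continuous_snd)).matrix_mul
          ((Units.continuous_coe_inv.comp continuous_subtype_val).comp continuous_fst))))
    · -- support ⊆ `tsupport β ×ˢ fst(e(A))`, `A` = elements of `H_w` inside `(tsupport β)⁻¹ · K_z`
      have hA : IsCompact {y : Subgroup.centralizer ({(⟨circleDiagonal 3 z₁, circleDiagonal_mem_archLocal_diagonal L 3 α w z₁⟩ : archLocal L 3 (Matrix.diagonal α) w)} : Set (archLocal L 3 (Matrix.diagonal α) w)) |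
          (y : archLocal L 3 (Matrix.diagonal α) w) ∈ (tsupport β)⁻¹ * tsupport (fun x : archLocal L 3 (Matrix.diagonal α) w => Θ (((x * (⟨circleDiagonal 3 z, circleDiagonal_mem_archLocal_diagonal L 3 α w z⟩ : archLocal L 3 (Matrix.diagonal α) w) * x⁻¹ : archLocal L 3 (Matrix.diagonal α) w) : GL (Fin 3) ℂ) : Matrix (Fin 3) (Fin 3) ℂ))} :=
        hZ.isClosedEmbedding_subtypeVal.isCompact_preimage (hβs.isCompact.inv.mul hus.isCompact)
      refine HasCompactSupport.intro (hβs.isCompact.prod ((hA.image e.continuous).image continuous_fst)) ?_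
      rintro ⟨g, h₂⟩ hgk
      simp only [Function.uncurry_apply_pair]
      by_cases hg : g ∈ tsupport β
      · have hh₂ : h₂ ∉ Prod.fst '' (e '' {y : Subgroup.centralizer ({(⟨circleDiagonal 3 z₁, circleDiagonal_mem_archLocal_diagonal L 3 α w z₁⟩ : archLocal L 3 (Matrix.diagonal α) w)} : Set (archLocal L 3 (Matrix.diagonal α) w)) |
            (y : archLocal L 3 (Matrix.diagonal α) w) ∈ (tsupport β)⁻¹ * tsupport (fun x : archLocal L 3 (Matrix.diagonal α) w => Θ (((x * (⟨circleDiagonal 3 z, circleDiagonal_mem_archLocal_diagonal L 3 α w z⟩ : archLocal L 3 (Matrix.diagonal α) w) * x⁻¹ : archLocal L 3 (Matrix.diagonal α) w) : GL (Fin 3) ℂ) : Matrix (Fin 3) (Fin 3) ℂ))}) :=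
          fun hh => hgk (Set.mk_mem_prod hg hh)
        have hzero : Θ (((g : GL (Fin 3) ℂ) : Matrix (Fin 3) (Fin 3) ℂ) * endoForm (((h₂ * ⟨circleDiagonal 2 ![z 0, z 2], (circleDiagonal_blocks_mem L α w z).1⟩ * h₂⁻¹ : unitaryGroupOfForm (starRingEnd ℂ) ((Matrix.diagonal ![α 0, α 2]).map w.1.embedding)) : GL (Fin 2) ℂ) : Matrix (Fin 2) (Fin 2) ℂ) ((circleDiagonal 1 ![z 1] : GL (Fin 1) ℂ) : Matrix (Fin 1) (Fin 1) ℂ) * (((g : GL (Fin 3) ℂ)⁻¹ : GL (Fin 3) ℂ) : Matrix (Fin 3) (Fin 3) ℂ)) = 0 := by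
          by_contra hne
          apply hh₂
          -- `x = ι(h₂, 1)`; the argument is `↑↑((g x) t_w z (g x)⁻¹)`
          have key := coe_conj_symm_conj_circleDiagonal L α w e he g (h₂, 1) z
          rw [← key] at hne
          have hne' : Θ ((((g * ((e.symm (h₂, 1) : Subgroup.centralizer ({(⟨circleDiagonal 3 z₁, circleDiagonal_mem_archLocal_diagonal L 3 α w z₁⟩ : archLocal L 3 (Matrix.diagonal α) w)} : Set (archLocal L 3 (Matrix.diagonal α) w))) : archLocal L 3 (Matrix.diagonal α) w)) * (⟨circleDiagonal 3 z, circleDiagonal_mem_archLocal_diagonal L 3 α w z⟩ : archLocal L 3 (Matrix.diagonal α) w) * (g * ((e.symm (h₂, 1) : Subgroup.centralizer ({(⟨circleDiagonal 3 z₁, circleDiagonal_mem_archLocal_diagonal L 3 α w z₁⟩ : archLocal L 3 (Matrix.diagonal α) w)} : Set (archLocal L 3 (Matrix.diagonal α) w))) : archLocal L 3 (Matrix.diagonal α) w))⁻¹ : archLocal L 3 (Matrix.diagonal α) w) : GL (Fin 3) ℂ) : Matrix (Fin 3) (Fin 3) ℂ) ≠ 0 := by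
            convert hne using 4
            simp only [mul_inv_rev, mul_assoc]
          have hgx := subset_tsupport (fun x : archLocal L 3 (Matrix.diagonal α) w => Θ (((x * (⟨circleDiagonal 3 z, circleDiagonal_mem_archLocal_diagonal L 3 α w z⟩ : archLocal L 3 (Matrix.diagonal α) w) * x⁻¹ : archLocal L 3 (Matrix.diagonal α) w) : GL (Fin 3) ℂ) : Matrix (Fin 3) (Fin 3) ℂ)) hne'
          refine ⟨(h₂, 1), ⟨e.symm (h₂, 1), ?_, e.apply_symm_apply _⟩, rfl⟩
          simp only [Set.mem_setOf_eq]
          rw [← inv_mul_cancel_left g (((e.symm (h₂, 1) : Subgroup.centralizer ({(⟨circleDiagonal 3 z₁, circleDiagonal_mem_archLocal_diagonal L 3 α w z₁⟩ : archLocal L 3 (Matrix.diagonal α) w)} : Set (archLocal L 3 (Matrix.diagonal α) w))) : archLocal L 3 (Matrix.diagonal α) w))]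
          exact Set.mul_mem_mul (Set.inv_mem_inv.mpr hg) hgx
        rw [hzero, mul_zero]
      · rw [image_eq_zero_of_notMem_tsupport hg, Complex.ofReal_zero, zero_mul]
  calc ∫ g, (β g : ℂ) * ((((c * (μ₁ Set.univ).toReal : ℝ)) : ℂ) * ∫ h₂ : unitaryGroupOfForm (starRingEnd ℂ) ((Matrix.diagonal ![α 0, α 2]).map w.1.embedding),
          Θ (((g : GL (Fin 3) ℂ) : Matrix (Fin 3) (Fin 3) ℂ) * endoForm (((h₂ * ⟨circleDiagonal 2 ![z 0, z 2], (circleDiagonal_blocks_mem L α w z).1⟩ * h₂⁻¹ : unitaryGroupOfForm (starRingEnd ℂ) ((Matrix.diagonal ![α 0, α 2]).map w.1.embedding)) : GL (Fin 2) ℂ) : Matrix (Fin 2) (Fin 2) ℂ) ((circleDiagonal 1 ![z 1] : GL (Fin 1) ℂ) : Matrix (Fin 1) (Fin 1) ℂ) * (((g : GL (Fin 3) ℂ)⁻¹ : GL (Fin 3) ℂ) : Matrix (Fin 3) (Fin 3) ℂ)) ∂μ₂) ∂ν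
      = ∫ g, (((c * (μ₁ Set.univ).toReal : ℝ)) : ℂ) * ∫ h₂ : unitaryGroupOfForm (starRingEnd ℂ) ((Matrix.diagonal ![α 0, α 2]).map w.1.embedding), (β g : ℂ) *
          Θ (((g : GL (Fin 3) ℂ) : Matrix (Fin 3) (Fin 3) ℂ) * endoForm (((h₂ * ⟨circleDiagonal 2 ![z 0, z 2], (circleDiagonal_blocks_mem L α w z).1⟩ * h₂⁻¹ : unitaryGroupOfForm (starRingEnd ℂ) ((Matrix.diagonal ![α 0, α 2]).map w.1.embedding)) : GL (Fin 2) ℂ) : Matrix (Fin 2) (Fin 2) ℂ) ((circleDiagonal 1 ![z 1] : GL (Fin 1) ℂ) : Matrix (Fin 1) (Fin 1) ℂ) * (((g : GL (Fin 3) ℂ)⁻¹ : GL (Fin 3) ℂ) : Matrix (Fin 3) (Fin 3) ℂ)) ∂μ₂ ∂ν := by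
        refine integral_congr_ae (Eventually.of_forall fun g => ?_)
        dsimp only
        rw [mul_left_comm, integral_const_mul]
    _ = (((c * (μ₁ Set.univ).toReal : ℝ)) : ℂ) * ∫ g, ∫ h₂ : unitaryGroupOfForm (starRingEnd ℂ) ((Matrix.diagonal ![α 0, α 2]).map w.1.embedding), (β g : ℂ) *
          Θ (((g : GL (Fin 3) ℂ) : Matrix (Fin 3) (Fin 3) ℂ) * endoForm (((h₂ * ⟨circleDiagonal 2 ![z 0, z 2], (circleDiagonal_blocks_mem L α w z).1⟩ * h₂⁻¹ : unitaryGroupOfForm (starRingEnd ℂ) ((Matrix.diagonal ![α 0, α 2]).map w.1.embedding)) : GL (Fin 2) ℂ) : Matrix (Fin 2) (Fin 2) ℂ) ((circleDiagonal 1 ![z 1] : GL (Fin 1) ℂ) : Matrix (Fin 1) (Fin 1) ℂ) * (((g : GL (Fin 3) ℂ)⁻¹ : GL (Fin 3) ℂ) : Matrix (Fin 3) (Fin 3) ℂ)) ∂μ₂ ∂ν := integral_const_mul _ _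
    _ = (((c * (μ₁ Set.univ).toReal : ℝ)) : ℂ) * ∫ h₂ : unitaryGroupOfForm (starRingEnd ℂ) ((Matrix.diagonal ![α 0, α 2]).map w.1.embedding), ∫ g, (β g : ℂ) *
          Θ (((g : GL (Fin 3) ℂ) : Matrix (Fin 3) (Fin 3) ℂ) * endoForm (((h₂ * ⟨circleDiagonal 2 ![z 0, z 2], (circleDiagonal_blocks_mem L α w z).1⟩ * h₂⁻¹ : unitaryGroupOfForm (starRingEnd ℂ) ((Matrix.diagonal ![α 0, α 2]).map w.1.embedding)) : GL (Fin 2) ℂ) : Matrix (Fin 2) (Fin 2) ℂ) ((circleDiagonal 1 ![z 1] : GL (Fin 1) ℂ) : Matrix (Fin 1) (Fin 1) ℂ) * (((g : GL (Fin 3) ℂ)⁻¹ : GL (Fin 3) ℂ) : Matrix (Fin 3) (Fin 3) ℂ)) ∂ν ∂μ₂ := by rw [integral_integral_swap hF₃i]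

/-! ## §3 Positivity, and the scalar `1` for the product centraliser measure -/

/-- `0 < haarScalarFactor ρ ((μ₂ × μ₁).map e⁻¹) · μ₁(univ)` (`G₁ ≅ S¹` is compact of positive finite mass). [cite: Folland1995, §2.2 Thm. 2.20] -/
theorem haarScalarFactor_mul_measure_univ_pos (hα : ∀ i, α i ≠ 0) (hreal : ∀ i, (w.1.embedding (α i)).im = 0)
    [SecondCountableTopology (archLocal L 3 (Matrix.diagonal α) w)] [LocallyCompactSpace (archLocal L 3 (Matrix.diagonal α) w)]
    [SecondCountableTopology (unitaryGroupOfForm (starRingEnd ℂ) ((Matrix.diagonal ![α 0, α 2]).map w.1.embedding))]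
    [LocallyCompactSpace (unitaryGroupOfForm (starRingEnd ℂ) ((Matrix.diagonal ![α 0, α 2]).map w.1.embedding))]
    [SecondCountableTopology (unitaryGroupOfForm (starRingEnd ℂ) ((Matrix.diagonal ![α 1]).map w.1.embedding))]
    [LocallyCompactSpace (unitaryGroupOfForm (starRingEnd ℂ) ((Matrix.diagonal ![α 1]).map w.1.embedding))]
    {z₀ : Fin 3 → Circle}
    (e : Subgroup.centralizer ({(⟨circleDiagonal 3 z₀, circleDiagonal_mem_archLocal_diagonal L 3 α w z₀⟩ : archLocal L 3 (Matrix.diagonal α) w)} :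
        Set (archLocal L 3 (Matrix.diagonal α) w)) ≃ₜ*
      (unitaryGroupOfForm (starRingEnd ℂ) ((Matrix.diagonal ![α 0, α 2]).map w.1.embedding) × unitaryGroupOfForm (starRingEnd ℂ) ((Matrix.diagonal ![α 1]).map w.1.embedding)))
    (ρ : Measure (Subgroup.centralizer ({(⟨circleDiagonal 3 z₀, circleDiagonal_mem_archLocal_diagonal L 3 α w z₀⟩ : archLocal L 3 (Matrix.diagonal α) w)} :
        Set (archLocal L 3 (Matrix.diagonal α) w)))) [ρ.IsHaarMeasure]
    (μ₂ : Measure (unitaryGroupOfForm (starRingEnd ℂ) ((Matrix.diagonal ![α 0, α 2]).map w.1.embedding))) [μ₂.IsHaarMeasure]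
    (μ₁ : Measure (unitaryGroupOfForm (starRingEnd ℂ) ((Matrix.diagonal ![α 1]).map w.1.embedding))) [μ₁.IsHaarMeasure] :
    haveI : ((μ₂.prod μ₁).map e.symm).IsHaarMeasure := ContinuousMulEquiv.isHaarMeasure_map (μ₂.prod μ₁) e.symm
    0 < (haarScalarFactor ρ ((μ₂.prod μ₁).map e.symm) : ℝ) * (μ₁ Set.univ).toReal := by
  haveI : ((μ₂.prod μ₁).map e.symm).IsHaarMeasure := ContinuousMulEquiv.isHaarMeasure_map (μ₂.prod μ₁) e.symm
  exact mul_pos (NNReal.coe_pos.mpr (haarScalarFactor_map_symm_pos _ e ρ (μ₂.prod μ₁))) (toReal_measure_univ_fin_one_unitary_pos L α w hα hreal μ₁)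

/-- **(n1) THE PRODUCT CENTRALISER MEASURE HAS SCALAR `1`**: for `ρ := (μ₂ × μ₁).map e⁻¹` (the shape of U4's top-form wall-block measure `θ^TF_w(β) = ι_*(μ₂^TF ⊗ μ₁^TF)`),
`haarScalarFactor ρ ((μ₂ × μ₁).map e⁻¹) = 1`, so the (d3a) constant is `c₀ = μ₁(univ)`. [cite: Folland1995, §2.2 Thm. 2.20] -/
theorem haarScalarFactor_map_symm_prod_self
    [SecondCountableTopology (archLocal L 3 (Matrix.diagonal α) w)] [LocallyCompactSpace (archLocal L 3 (Matrix.diagonal α) w)]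
    [SecondCountableTopology (unitaryGroupOfForm (starRingEnd ℂ) ((Matrix.diagonal ![α 0, α 2]).map w.1.embedding))]
    [LocallyCompactSpace (unitaryGroupOfForm (starRingEnd ℂ) ((Matrix.diagonal ![α 0, α 2]).map w.1.embedding))]
    [SecondCountableTopology (unitaryGroupOfForm (starRingEnd ℂ) ((Matrix.diagonal ![α 1]).map w.1.embedding))]
    [LocallyCompactSpace (unitaryGroupOfForm (starRingEnd ℂ) ((Matrix.diagonal ![α 1]).map w.1.embedding))]
    {z₀ : Fin 3 → Circle}
    (e : Subgroup.centralizer ({(⟨circleDiagonal 3 z₀, circleDiagonal_mem_archLocal_diagonal L 3 α w z₀⟩ : archLocal L 3 (Matrix.diagonal α) w)} :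
        Set (archLocal L 3 (Matrix.diagonal α) w)) ≃ₜ*
      (unitaryGroupOfForm (starRingEnd ℂ) ((Matrix.diagonal ![α 0, α 2]).map w.1.embedding) × unitaryGroupOfForm (starRingEnd ℂ) ((Matrix.diagonal ![α 1]).map w.1.embedding)))
    (μ₂ : Measure (unitaryGroupOfForm (starRingEnd ℂ) ((Matrix.diagonal ![α 0, α 2]).map w.1.embedding))) [μ₂.IsHaarMeasure]
    (μ₁ : Measure (unitaryGroupOfForm (starRingEnd ℂ) ((Matrix.diagonal ![α 1]).map w.1.embedding))) [μ₁.IsHaarMeasure]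
    (ρ : Measure (Subgroup.centralizer ({(⟨circleDiagonal 3 z₀, circleDiagonal_mem_archLocal_diagonal L 3 α w z₀⟩ : archLocal L 3 (Matrix.diagonal α) w)} :
        Set (archLocal L 3 (Matrix.diagonal α) w)))) [ρ.IsHaarMeasure] (hρ : ρ = (μ₂.prod μ₁).map e.symm) :
    haveI : ((μ₂.prod μ₁).map e.symm).IsHaarMeasure := ContinuousMulEquiv.isHaarMeasure_map (μ₂.prod μ₁) e.symm
    haarScalarFactor ρ ((μ₂.prod μ₁).map e.symm) = 1 := by
  subst hρ
  haveI : ((μ₂.prod μ₁).map e.symm).IsHaarMeasure := ContinuousMulEquiv.isHaarMeasure_map (μ₂.prod μ₁) e.symm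
  exact haarScalarFactor_self _

end Wall

end UnitaryGroup

end Literature.NumberTheory.Automorphic

end
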